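import Summits.QuantumFields.YangMills.Theorems.BalabanUVNodesN14DressedStability

/-!
# BalabanUVNodes ∕ node N14 = NE1′ — the edge N14 → N19 ON THE TERM-WISE ROAD OF RECORD: N14's pinned pair delivers
# N19's ONE-RUN SIZE binder `hS` ∕ `hSle` at the DRESSED slices of the E-ledger, K-free (`m = 0`), letter `a = ρ·Λ₀ < 1`,
# and the ONE link the rate-record predicate must carry for `N14At` to be consumed at all

Cell `pub-ymgap`, HUMAN RULING D-0062 (Track A at full width), seat `pub-ymgap-dag-n14-a` (-a KNIT-BY-NAME), generation 2;
route `Summits/QuantumFields/YangMills/Theses/BalabanUVNodes.lean` (item `SpineGivenEndpoint`, cluster K4 «SpineRates» →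
K5 «SpineMatching»); venue ruling R424.  THEOREMS ONLY (no `def`, no `def … : Prop`); imports this seat's generation-0 module
`BalabanUVNodesN14DressedStability` ONLY (through it the NE1′ owner lineage's `Spine/NE1p/DressedRootStrictSeparation`,
`DressedRootStrict` — ROOT-C OF RECORD —, `DressedRoot`, `DressedRootWitness`, and `T4TermFormat`); modifies nothing; every
cited lemma is used BY NAME.

WHY THIS FILE (the design word of record it answers).  Plan ruling [YMPLAN-G61-WORD-U3-DRESSED] (pub-ymgap INBOX l.10200,
2026-08-26; executed in the dagwriter's module-2 v2 `BalabanUVNodesSpineRates.lean` 32834efdae424a70, `U3Carriers` docstring):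
the node-U3 carriers OF RECORD INCLUDE the observable-attached (dressed) domains — `C.Dom := Dom₀ ⊕ (Dom₀ × T)`, `EA g U (X,t) :=
D_t(X; g, U)` the dressed piece — so on N19's term-wise road of record (dag-n19-a's knits `N19CoreKnit` p409134 …
`N19ConstantsWindowU2Output` p412947, `N19OtherKindsU5b` p413531) the dressed pieces ride in the E-ledger `fac K t τ` and the
TWO-RUN rates are N18∕N22's at the same letters.  Those knits carry ONE-RUN SIZE binders `hS`∕`hSle`
(`N19ConstantsWindowU2Output.core_summable_of_nodes_window` :123∕:129): per good term and scale slice `j ≤ K`,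
`|Σ_{X ∈ fac K t τ, scale X = j} ((E^B(u_B;X) − E^B(1;X)) − (E^A(u_A;X) − E^A(1;X)))| ≤ S K t τ j ≤ vol·(E₀·(K+1)^m·a^{K−j})`,
`0 < a < 1`.  At the VACUUM slices that binder is [Balaban1988Convergent] Thm 2 (2.43) = N11's leaf, read by n19-b's
`N19SizeWindow.sizeBinder_of_thm2Printed` (p409886) from `B14.Thm2Printed` — which knows no dressed term.  AT THE DRESSED SLICES THE
ONE-RUN SIZE, UNIFORM IN THE SOURCE `t`, IS NODE N14 — «dressed stability of the observable-attached terms, μ- and K-uniform»,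
statement of record `NE1p.DressedRoot.DressedStabilityStrict 𝒯 Λ` (`Spine/NE1p/DressedRootStrict.lean` :58).  This file is that
arrow BY NAME, so that `S_N19`'s assembler consumes `N14At R.ne1` (module 2's `RatesAt.1`) instead of leaving the dressed
size an unbooked burden inside `S_N19` or re-booking it under N18∕N22:

* §1 FINITE-SUM GLUE [folklore]: `abs_sliceSum_sub_le` — a slice's two-run discrepancy from per-domain domination and a slice
  COUNT; `abs_sliceSum_split` — a ledger slice splits into its vacuum and dressed parts; `card_slice_le_of_feltAt` ∕
  `card_slice_le_of_topCubes` — the slice count from `T4TermFormat.Booking.PositionalCount` through an injection of the slice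
  into the births felt at top-scale tube cubes (`≤ #Q·N₀Λ₀^{K−j}`).
* §2 THE FACE.  `size_final_le_of_with` (the class read at the final scale: `size b K ≤ A₀·(ρ₁τ)^{K−j}`);
  **`sizeBinder_dressed_of_with`** — displayed constants: `DressedStabilityWith 𝒯 A₀ ρ₁ τ` and, for a ledger slice family
  `(wf, sc, e_A, e_B)` IDENTIFIED with births of the bookings of run A at `(p_A, K_A)` and of run B at `(p_B, K_B)` (birth
  scales aligned with the ledger's scales relative to the cutoffs; per-domain domination `|e X| ≤ size (β X) K` — the booked
  size IS the sup over admissible backgrounds; slice count `≤ vol·N₀Λ₀^{K−j}`), N19's literal pair: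
  `|Σ_{sc X = j}(e_B X − e_A X)| ≤ vol·((2N₀A₀)·((ρ₁τ)·Λ₀)^{K−j})` for every `j ≤ K` — ONE `(A₀, ρ₁τ)` FOR ALL run parameters,
  hence for every source `|t| ≤ l₀` and both runs (the quantifier order of NE1′ made visible on N19's road);
  **`sizeBinder_dressed_of_n14`** — from the root of record `DressedStabilityStrict 𝒯 Λ` and a count rate `0 ≤ Λ₀ ≤ Λ`:
  constants `A₀, ρ ≥ 0` with the LETTER `ρ·Λ₀ < 1` (N14's strict product, `dressedStabilityStrict_iff_lt_one`) and the same
  conclusion — `m = 0`: NO `(K+1)^m`, the dressed amplitude is K-FREE (contrast (2.43)'s polynomial weight);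
  **`sizeBinder_dressed_of_n14_pinned`** — THE PINNED PAIR of module 1 §4 (`n14_rate_pin`): N14 at `Λ` ∧ the bookings'
  `PositionalCount (N₀Λ₀^{k−j})`, `Λ₀ ≤ Λ`, with the slice injected into run A's births felt at `≤ vol` top cubes — the count
  binder DERIVED (§1), only the identification displayed.
* §3 THE GLUE `S_N19`'s ASSEMBLER NEEDS [folklore]: `sizeProfile_join` — a vacuum profile `vol·(E₁(K+1)^m·a₁^{K−j})` and a
  dressed profile `vol·(E₂·a₂^{K−j})` add to ONE `hSle` profile `vol·((E₁+E₂)(K+1)^m·a^{K−j})` for any `a ≥ max(a₁,a₂)`;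
  `hSle_of_vacuum_add_dressed` — the slice form.
* §4 GUARD [decided toy]: on the owner's `toyTower` (rate `2`, multiplicity `1`, positive sizes) a one-domain ledger reading the
  toy's own size with a NONZERO discrepancy meets every displayed identification binder, and §2 fires
  (`sizeBinder_dressed_toyTower`) — the binder list is jointly satisfiable, non-degenerately.

TYPING NOTE FOR THE REV-1 PACKAGE (plan ∕ dagwriter ∕ NODE 00; kernel content = the hypotheses of §2, nothing else).  Module 2's
K4 hook hands `S_N19` the conjunct `N14At R.ne1 = DressedStabilityStrict R.ne1.𝒯 R.ne1.Λ` (`RatesAt.1`); NO landed K5 knit consumes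
it today.  It is consumed EXACTLY through §2, whose displayed binders are the LINK the rate-record predicate `RRec` must carry
between the sub-bundles `R.ne1` and `R.u3`: (ℓ1) every dressed index `(X, t)` of scale `j` in a good term's ledger `fac K t τ` is a
birth of `R.ne1.𝒯.B p K` of birth scale `j` (run A; `j+1` at cutoff `K+1` for run B's synchronised booking), injectively, felt at
a top tube cube; (ℓ2) `|R.u3.EA g u (X,t) − R.u3.EA g 1 (X,t)| ≤ size b K` on the admissible backgrounds; (ℓ3) `R.ne1.Λ ≥ Λ₀`, the
bookings' positional count rate (module 1's rate pin).  With (ℓ1)–(ℓ3) in `RRec`, N14 ⇒ N19's (S) at dressed slices is this file;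
without them `N14At` is idle in `RatesAt` and the dressed one-run size is an unbooked burden of `S_N19`.

HONEST FRAMING.  Kernel bookkeeping BY NAME over hypothesis SHAPES and finite sums; 0 sorry; nothing of Bałaban's densities is
asserted or instantiated; the identification binders (ℓ1)–(ℓ3) are DISPLAYED, discharged by nobody (NODE O ∕ the record
predicate); NE1′ is NOT PRINTED ([Balaban1989LargeFieldII] (1.73)–(1.75) pp. 379–380 type the action only; p. 356 ll. 1–6) and
NOT PROVED; NE7 NOT proved; no carrier of N14 is pinned by NODE 00 ⇒ count-neutral (discharged count unmoved).  One finite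
four-torus at fixed ε; NOT infinite volume, NOT OS on ℝ⁴, NOT a mass gap, NOT Clay.
-/

noncomputable section

namespace YMDAG.N14

open Finset
open scoped BigOperators
open Literature.MathematicalPhysics.QuantumFieldTheory.Balaban1983to89
open Literature.MathematicalPhysics.QuantumFieldTheory.Balaban1983to89.T4TermFormat
open Summit.QuantumFields.BalabanUV.T4Continuum.NE1p.DressedRoot
open Literature.MathematicalPhysics.QuantumFieldTheory.Balaban1983to89.T4TermFormat.Booking (mem_feltOfScale)
open Summit.QuantumFields.BalabanUV.T4Continuum.NE1p.DressedRootStrictSeparation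

/-! ## §1 Finite-sum glue: slice discrepancies from per-domain domination and a count; the count from positional counts -/

section Glue

variable {D : Type*}

/-- **A SLICE's TWO-RUN DISCREPANCY FROM PER-DOMAIN DOMINATION AND A COUNT** [folklore]: if on the scale-`j` slice of the
ledger `wf` run A's entries are `≤ σA`, run B's `≤ σB` in absolute value (`σA, σB ≥ 0`) and the slice has at most `cnt`
members, then `|Σ_{X ∈ wf, sc X = j} (e_B X − e_A X)| ≤ (σA + σB)·cnt`. -/
theorem abs_sliceSum_sub_le (wf : Finset D) (sc : D → ℕ) (eA eB : D → ℝ) (j : ℕ) {σA σB cnt : ℝ}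
    (hA : ∀ X ∈ wf, sc X = j → |eA X| ≤ σA) (hB : ∀ X ∈ wf, sc X = j → |eB X| ≤ σB)
    (hσA : 0 ≤ σA) (hσB : 0 ≤ σB) (hcnt : ((wf.filter fun X => sc X = j).card : ℝ) ≤ cnt) :
    |∑ X ∈ wf with sc X = j, (eB X - eA X)| ≤ (σA + σB) * cnt := by
  calc |∑ X ∈ wf with sc X = j, (eB X - eA X)|
      ≤ ∑ X ∈ wf with sc X = j, |eB X - eA X| := abs_sum_le_sum_abs _ _
    _ ≤ ∑ X ∈ wf with sc X = j, (σA + σB) := by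
        refine sum_le_sum fun X hX => ?_
        obtain ⟨hXw, hXj⟩ := mem_filter.mp hX
        calc |eB X - eA X| ≤ |eB X| + |eA X| := abs_sub _ _
          _ ≤ σB + σA := add_le_add (hB X hXw hXj) (hA X hXw hXj)
          _ = σA + σB := add_comm _ _
    _ = ((wf.filter fun X => sc X = j).card : ℝ) * (σA + σB) := by rw [sum_const, nsmul_eq_mul]
    _ ≤ cnt * (σA + σB) := mul_le_mul_of_nonneg_right hcnt (add_nonneg hσA hσB)
    _ = (σA + σB) * cnt := mul_comm _ _

/-- **A LEDGER SLICE SPLITS INTO ITS VACUUM AND DRESSED PARTS** [folklore]: for any decidable mark `dressed` on the ledger,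
`|Σ_{wf, sc = j} f| ≤ |Σ_{wf ∖ dressed, sc = j} f| + |Σ_{wf ∩ dressed, sc = j} f|`. -/
theorem abs_sliceSum_split (wf : Finset D) (sc : D → ℕ) (f : D → ℝ) (j : ℕ) (dressed : D → Prop)
    [DecidablePred dressed] :
    |∑ X ∈ wf with sc X = j, f X| ≤
      |∑ X ∈ (wf.filter fun X => ¬ dressed X) with sc X = j, f X| +
        |∑ X ∈ (wf.filter dressed) with sc X = j, f X| := by
  have h1 : (wf.filter dressed).filter (fun X => sc X = j) = (wf.filter fun X => sc X = j).filter dressed :=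
    Finset.filter_comm _ _ _
  have h2 : (wf.filter fun X => ¬ dressed X).filter (fun X => sc X = j) =
      (wf.filter fun X => sc X = j).filter (fun X => ¬ dressed X) :=
    Finset.filter_comm _ _ _
  rw [h1, h2, ← sum_filter_add_sum_filter_not (wf.filter fun X => sc X = j) dressed f]
  exact (abs_add_le _ _).trans_eq (add_comm _ _)

variable {Bk : T4TermFormat.Booking}

/-- **THE SLICE COUNT FROM POSITIONAL COUNTS** [folklore]: if the scale-`j` slice of the ledger is identified INJECTIVELY (`β`)
with births of scale `j` each felt at some cube of the finite set `Q`, and the booking has `PositionalCount N`, then the slice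
has at most `Σ_{q ∈ Q} N j (scale q)` members (`card_le_card_of_injOn` into `⋃_{q ∈ Q} feltOfScale q j`, `card_biUnion_le`). -/
theorem card_slice_le_of_feltAt (wf : Finset D) (sc : D → ℕ) (j : ℕ) (Q : Finset Bk.Cube) (β : D → Bk.Birth)
    {N : ℕ → ℕ → ℝ} (hN : Bk.PositionalCount N)
    (hsc : ∀ X ∈ wf, sc X = j → Bk.birthScale (β X) = j)
    (hfelt : ∀ X ∈ wf, sc X = j → ∃ q ∈ Q, β X ∈ Bk.feltAt q)
    (hinj : Set.InjOn β ↑(wf.filter fun X => sc X = j)) :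
    ((wf.filter fun X => sc X = j).card : ℝ) ≤ ∑ q ∈ Q, N j (Bk.cubeScale q) := by
  classical
  have hmaps : ∀ X ∈ wf.filter (fun X => sc X = j), β X ∈ Q.biUnion fun q => Bk.feltOfScale q j := by
    intro X hX
    obtain ⟨hXw, hXj⟩ := mem_filter.mp hX
    obtain ⟨q, hq, hb⟩ := hfelt X hXw hXj
    exact mem_biUnion.mpr ⟨q, hq, mem_feltOfScale.mpr ⟨hb, hsc X hXw hXj⟩⟩
  have h1 : (wf.filter fun X => sc X = j).card ≤ (Q.biUnion fun q => Bk.feltOfScale q j).card :=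
    card_le_card_of_injOn β (by intro X hX; exact hmaps X hX) hinj
  have h2 : (Q.biUnion fun q => Bk.feltOfScale q j).card ≤ ∑ q ∈ Q, (Bk.feltOfScale q j).card := card_biUnion_le
  calc ((wf.filter fun X => sc X = j).card : ℝ) ≤ ((Q.biUnion fun q => Bk.feltOfScale q j).card : ℝ) := by
        exact_mod_cast h1
    _ ≤ ((∑ q ∈ Q, (Bk.feltOfScale q j).card : ℕ) : ℝ) := by exact_mod_cast h2
    _ = ∑ q ∈ Q, ((Bk.feltOfScale q j).card : ℝ) := by push_cast; rfl
    _ ≤ ∑ q ∈ Q, N j (Bk.cubeScale q) := sum_le_sum fun q _ => hN q j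

/-- **… AT THE TOP CUBES WITH THE K-FREE RATE** [folklore]: with `PositionalCount (N₀Λ₀^{k−j})`, the slice injected into births
felt at TOP cubes (`scale q = Bk.K`) of a finite set `Q` with `#Q ≤ vol`: the slice count is `≤ vol·(N₀Λ₀^{K−j})` (`N₀, Λ₀ ≥ 0`). -/
theorem card_slice_le_of_topCubes (wf : Finset D) (sc : D → ℕ) (j : ℕ) (Q : Finset Bk.Cube) (β : D → Bk.Birth)
    {N₀ Λ₀ vol : ℝ} (hN : Bk.PositionalCount fun j k => N₀ * Λ₀ ^ (k - j)) (hN₀ : 0 ≤ N₀) (hΛ₀ : 0 ≤ Λ₀)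
    (htop : ∀ q ∈ Q, Bk.cubeScale q = Bk.K) (hvol : (Q.card : ℝ) ≤ vol)
    (hsc : ∀ X ∈ wf, sc X = j → Bk.birthScale (β X) = j)
    (hfelt : ∀ X ∈ wf, sc X = j → ∃ q ∈ Q, β X ∈ Bk.feltAt q)
    (hinj : Set.InjOn β ↑(wf.filter fun X => sc X = j)) :
    ((wf.filter fun X => sc X = j).card : ℝ) ≤ vol * (N₀ * Λ₀ ^ (Bk.K - j)) := by
  have h := card_slice_le_of_feltAt wf sc j Q β hN hsc hfelt hinj
  have hQ : ∑ q ∈ Q, N₀ * Λ₀ ^ (Bk.cubeScale q - j) = (Q.card : ℝ) * (N₀ * Λ₀ ^ (Bk.K - j)) := by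
    rw [sum_congr rfl fun q hq => by rw [htop q hq], sum_const, nsmul_eq_mul]
  have hnn : 0 ≤ N₀ * Λ₀ ^ (Bk.K - j) := mul_nonneg hN₀ (pow_nonneg hΛ₀ _)
  calc ((wf.filter fun X => sc X = j).card : ℝ) ≤ ∑ q ∈ Q, N₀ * Λ₀ ^ (Bk.cubeScale q - j) := h
    _ = (Q.card : ℝ) * (N₀ * Λ₀ ^ (Bk.K - j)) := hQ
    _ ≤ vol * (N₀ * Λ₀ ^ (Bk.K - j)) := mul_le_mul_of_nonneg_right hvol hnn

end Glue

/-! ## §2 The face: N14 (displayed constants ∕ root of record ∕ pinned pair) ⇒ N19's `hS` ∧ `hSle` at the dressed slices -/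

section Face

variable {P : Type*} {𝒯 : DressedTower P}

/-- **THE CLASS READ AT THE FINAL SCALE** [bookkeeping]: under `DressedStabilityWith 𝒯 A₀ ρ₁ τ` every booked observable-attached
term of the cutoff-`K` booking of ANY run parameter has final-scale size `≤ A₀·(ρ₁τ)^{K−j}`, `j` its birth scale
(`twoRate A₀ ρ₁ τ K j K = A₀ρ₁^{K−j}τ^{K−j}`; module 1's `unitLattice_of_n14` reads the same inside an `∃`). [folklore] -/
theorem size_final_le_of_with {A₀ ρ₁ τ : ℝ} (hW : DressedStabilityWith 𝒯 A₀ ρ₁ τ) (p : P) (K : ℕ) (b : (𝒯.B p K).Birth) :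
    (𝒯.B p K).size b K ≤ A₀ * (ρ₁ * τ) ^ (K - (𝒯.B p K).birthScale b) := by
  have hK := 𝒯.K_eq p K
  have hb : (𝒯.B p K).birthScale b ≤ (𝒯.B p K).K := (𝒯.B p K).birth_le b
  have hc := hW.2.2.2.2 p K b (𝒯.B p K).K hb le_rfl
  rw [hK] at hc
  calc (𝒯.B p K).size b K ≤ twoRate A₀ ρ₁ τ K ((𝒯.B p K).birthScale b) K := hc
    _ = A₀ * (ρ₁ * τ) ^ (K - (𝒯.B p K).birthScale b) := by unfold twoRate; rw [mul_pow]; ring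

/-- **N14 WITH DISPLAYED CONSTANTS ⇒ N19's (S) AT THE DRESSED SLICES** [bookkeeping].  Data: a ledger slice family over `D`
(`wf`, scales `sc`, run A's ∕ run B's one-run entries `e_A`, `e_B` — on N19's road `e X = E(u; X) − E(1; X)` at a fixed
admissible background), a volume `vol`, a top scale `K`; IDENTIFICATION with the dressed tower's bookings: run A = parameter `p_A`
at cutoff `K_A` with birth map `β_A`, run B = `p_B` at `K_B` with `β_B`, birth scales ALIGNED with the ledger's scales relative to
the cutoffs (`K_A − j(β_A X) = K − sc X`, and the same for B — run B's synchronised booking at cutoff `K+1` books run A's scale `j`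
as `j+1`), PER-DOMAIN DOMINATION by the booked final-scale sizes (`|e_A X| ≤ size (β_A X) K_A`, `|e_B X| ≤ size (β_B X) K_B`), and
the slice COUNT `≤ vol·N₀Λ₀^{K−j}`.  Conclusion, for `DressedStabilityWith 𝒯 A₀ ρ₁ τ`, `N₀, Λ₀ ≥ 0`: for every `j ≤ K`,
`|Σ_{X ∈ wf, sc X = j}(e_B X − e_A X)| ≤ vol·((2N₀A₀)·((ρ₁τ)·Λ₀)^{K−j})` — N19's `hS` with `S K t τ j :=` the right side and `hSle`
with `E₀ := 2N₀A₀`, `m := 0`, `a := (ρ₁τ)·Λ₀`.  ONE `(A₀, ρ₁, τ)` serves EVERY `p_A, p_B` — every source `t` of the window and both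
runs: the μ-uniformity of NE1′ on N19's road.  The identification binders are displayed, discharged by nobody. [folklore] -/
theorem sizeBinder_dressed_of_with {A₀ ρ₁ τ N₀ Λ₀ : ℝ} (hW : DressedStabilityWith 𝒯 A₀ ρ₁ τ)
    {D : Type*} (wf : Finset D) (sc : D → ℕ) (eA eB : D → ℝ) (vol : ℝ) (K : ℕ)
    (pA : P) (KA : ℕ) (βA : D → (𝒯.B pA KA).Birth) (pB : P) (KB : ℕ) (βB : D → (𝒯.B pB KB).Birth)
    (hscA : ∀ X ∈ wf, KA - (𝒯.B pA KA).birthScale (βA X) = K - sc X)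
    (hscB : ∀ X ∈ wf, KB - (𝒯.B pB KB).birthScale (βB X) = K - sc X)
    (hdomA : ∀ X ∈ wf, |eA X| ≤ (𝒯.B pA KA).size (βA X) KA)
    (hdomB : ∀ X ∈ wf, |eB X| ≤ (𝒯.B pB KB).size (βB X) KB)
    (hcnt : ∀ j, j ≤ K → ((wf.filter fun X => sc X = j).card : ℝ) ≤ vol * (N₀ * Λ₀ ^ (K - j))) :
    ∀ j, j ≤ K → |∑ X ∈ wf with sc X = j, (eB X - eA X)| ≤ vol * ((2 * N₀ * A₀) * ((ρ₁ * τ) * Λ₀) ^ (K - j)) := by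
  intro j hj
  have hA₀ : 0 ≤ A₀ := hW.1
  have hρ : 0 ≤ ρ₁ * τ := mul_nonneg hW.2.1 hW.2.2.1
  have hσ : 0 ≤ A₀ * (ρ₁ * τ) ^ (K - j) := mul_nonneg hA₀ (pow_nonneg hρ _)
  have hA : ∀ X ∈ wf, sc X = j → |eA X| ≤ A₀ * (ρ₁ * τ) ^ (K - j) := fun X hX hXj =>
    (hdomA X hX).trans (by rw [← hXj, ← hscA X hX]; exact size_final_le_of_with hW pA KA (βA X))
  have hB : ∀ X ∈ wf, sc X = j → |eB X| ≤ A₀ * (ρ₁ * τ) ^ (K - j) := fun X hX hXj =>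
    (hdomB X hX).trans (by rw [← hXj, ← hscB X hX]; exact size_final_le_of_with hW pB KB (βB X))
  calc |∑ X ∈ wf with sc X = j, (eB X - eA X)|
      ≤ (A₀ * (ρ₁ * τ) ^ (K - j) + A₀ * (ρ₁ * τ) ^ (K - j)) * (vol * (N₀ * Λ₀ ^ (K - j))) :=
        abs_sliceSum_sub_le wf sc eA eB j hA hB hσ hσ (hcnt j hj)
    _ = vol * ((2 * N₀ * A₀) * ((ρ₁ * τ) * Λ₀) ^ (K - j)) := by rw [mul_pow]; ring

/-- **N14's ROOT OF RECORD ⇒ N19's (S) AT THE DRESSED SLICES, WITH THE LETTER** [bookkeeping]: from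
`DressedStabilityStrict 𝒯 Λ`, a count rate `Λ₀ ≤ Λ` and any multiplicity letter `N₀`: constants `A₀, ρ ≥ 0` with
**`ρ·Λ₀ < 1`** — N14's strict product `Λρ₁τ < 1` (`dressedStabilityStrict_iff_lt_one`) at the dominated rate — such that every
ledger slice family identified with the bookings as in `sizeBinder_dressed_of_with` obeys, for every `j ≤ K`,
`|Σ_{sc X = j}(e_B X − e_A X)| ≤ vol·((2N₀A₀)·(ρΛ₀)^{K−j})`: N19's `hS` ∧ `hSle` with `E₀ = 2N₀A₀`, **`m = 0`** (the dressed
amplitude is K-FREE — contrast the vacuum binder's `(K+1)^m` from (2.43)'s recent log window) and `a = ρΛ₀ < 1`.  [folklore] -/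
theorem sizeBinder_dressed_of_n14 {Λ Λ₀ : ℝ} (N₀ : ℝ) (h : DressedStabilityStrict 𝒯 Λ) (hle : Λ₀ ≤ Λ) :
    ∃ A₀ ρ : ℝ, 0 ≤ A₀ ∧ 0 ≤ ρ ∧ ρ * Λ₀ < 1 ∧
      ∀ {D : Type} (wf : Finset D) (sc : D → ℕ) (eA eB : D → ℝ) (vol : ℝ) (K : ℕ)
        (pA : P) (KA : ℕ) (βA : D → (𝒯.B pA KA).Birth) (pB : P) (KB : ℕ) (βB : D → (𝒯.B pB KB).Birth),
        (∀ X ∈ wf, KA - (𝒯.B pA KA).birthScale (βA X) = K - sc X) →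
        (∀ X ∈ wf, KB - (𝒯.B pB KB).birthScale (βB X) = K - sc X) →
        (∀ X ∈ wf, |eA X| ≤ (𝒯.B pA KA).size (βA X) KA) →
        (∀ X ∈ wf, |eB X| ≤ (𝒯.B pB KB).size (βB X) KB) →
        (∀ j, j ≤ K → ((wf.filter fun X => sc X = j).card : ℝ) ≤ vol * (N₀ * Λ₀ ^ (K - j))) →
        ∀ j, j ≤ K → |∑ X ∈ wf with sc X = j, (eB X - eA X)| ≤ vol * ((2 * N₀ * A₀) * (ρ * Λ₀) ^ (K - j)) := by
  obtain ⟨A₀, ρ₁, τ, hW, _, h1⟩ := dressedStabilityStrict_iff_lt_one.mp h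
  have hρ : 0 ≤ ρ₁ * τ := mul_nonneg hW.2.1 hW.2.2.1
  refine ⟨A₀, ρ₁ * τ, hW.1, hρ, ?_, fun wf sc eA eB vol K pA KA βA pB KB βB hscA hscB hdomA hdomB hcnt =>
    sizeBinder_dressed_of_with hW wf sc eA eB vol K pA KA βA pB KB βB hscA hscB hdomA hdomB hcnt⟩
  calc ρ₁ * τ * Λ₀ ≤ ρ₁ * τ * Λ := mul_le_mul_of_nonneg_left hle hρ
    _ = Λ * ρ₁ * τ := by ring
    _ < 1 := h1

/-- **THE PINNED PAIR ⇒ N19's (S) AT THE DRESSED SLICES, COUNT DERIVED** [bookkeeping]: N14 at `Λ` TOGETHER WITH the bookings'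
positional counts `PositionalCount (N₀Λ₀^{k−j})` at a rate `0 ≤ Λ₀ ≤ Λ` (the pair module 1's `n14_rate_pin` says the record must
pin) give constants `A₀, ρ ≥ 0`, `ρΛ₀ < 1`, such that for every ledger slice family identified with the bookings — run A's birth map
moreover INJECTIVE on each slice, birth scale `= sc X` at cutoff `K_A = K`, each birth felt at one of `≤ vol` TOP cubes `Q` — the
conclusion of `sizeBinder_dressed_of_n14` holds; the slice count is §1's `card_slice_le_of_topCubes`, no longer a binder.  [folklore] -/
theorem sizeBinder_dressed_of_n14_pinned {Λ Λ₀ N₀ : ℝ}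
    (h : DressedStabilityStrict 𝒯 Λ ∧ ∀ p K, (𝒯.B p K).PositionalCount fun j k => N₀ * Λ₀ ^ (k - j))
    (hN₀ : 0 ≤ N₀) (h0 : 0 ≤ Λ₀) (hle : Λ₀ ≤ Λ) :
    ∃ A₀ ρ : ℝ, 0 ≤ A₀ ∧ 0 ≤ ρ ∧ ρ * Λ₀ < 1 ∧
      ∀ {D : Type} (wf : Finset D) (sc : D → ℕ) (eA eB : D → ℝ) (vol : ℝ) (K : ℕ)
        (pA : P) (βA : D → (𝒯.B pA K).Birth) (Q : Finset (𝒯.B pA K).Cube)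
        (pB : P) (KB : ℕ) (βB : D → (𝒯.B pB KB).Birth),
        (∀ X ∈ wf, (𝒯.B pA K).birthScale (βA X) = sc X) →
        (∀ j, Set.InjOn βA ↑(wf.filter fun X => sc X = j)) →
        (∀ q ∈ Q, (𝒯.B pA K).cubeScale q = K) → ((Q.card : ℝ) ≤ vol) →
        (∀ X ∈ wf, ∃ q ∈ Q, βA X ∈ (𝒯.B pA K).feltAt q) →
        (∀ X ∈ wf, KB - (𝒯.B pB KB).birthScale (βB X) = K - sc X) →
        (∀ X ∈ wf, |eA X| ≤ (𝒯.B pA K).size (βA X) K) →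
        (∀ X ∈ wf, |eB X| ≤ (𝒯.B pB KB).size (βB X) KB) →
        ∀ j, j ≤ K → |∑ X ∈ wf with sc X = j, (eB X - eA X)| ≤ vol * ((2 * N₀ * A₀) * (ρ * Λ₀) ^ (K - j)) := by
  obtain ⟨A₀, ρ, hA₀, hρ, h1, hface⟩ := sizeBinder_dressed_of_n14 N₀ h.1 hle
  refine ⟨A₀, ρ, hA₀, hρ, h1, fun wf sc eA eB vol K pA βA Q pB KB βB hsc hinj htop hvol hfelt hscB hdomA hdomB => ?_⟩
  have hKA : (𝒯.B pA K).K = K := 𝒯.K_eq pA K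
  refine hface wf sc eA eB vol K pA K βA pB KB βB (fun X hX => by rw [hsc X hX]) hscB hdomA hdomB fun j _ => ?_
  have hc := card_slice_le_of_topCubes wf sc j Q βA (h.2 pA K) hN₀ h0 (fun q hq => (htop q hq).trans hKA.symm) hvol
    (fun X hX hXj => (hsc X hX).trans hXj) (fun X hX _ => hfelt X hX) (hinj j)
  rwa [hKA] at hc

end Face

/-! ## §3 The glue `S_N19`'s assembler needs: vacuum profile ⊕ dressed profile = ONE `hSle` profile -/

section Join

/-- Monotonicity of the profile in its letter: `a₁ ≤ a` gives `vol·(E·w·a₁^{n}) ≤ vol·(E·w·a^{n})` (`vol, E, w, a₁ ≥ 0`). [folklore] -/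
theorem profile_mono {vol E w a₁ a : ℝ} (hvol : 0 ≤ vol) (hE : 0 ≤ E) (hw : 0 ≤ w) (ha₁ : 0 ≤ a₁) (h : a₁ ≤ a) (n : ℕ) :
    vol * (E * w * a₁ ^ n) ≤ vol * (E * w * a ^ n) :=
  mul_le_mul_of_nonneg_left (mul_le_mul_of_nonneg_left (pow_le_pow_left₀ ha₁ h n) (mul_nonneg hE hw)) hvol

/-- **VACUUM ⊕ DRESSED = ONE PROFILE** [folklore]: a vacuum size `S₁ ≤ vol·(E₁·(K+1)^m·a₁^{K−j})` (n19-b's binder from (2.43)) and a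
dressed size `S₂ ≤ vol·(E₂·a₂^{K−j})` (§2, `m = 0`) give `S₁ + S₂ ≤ vol·((E₁+E₂)·(K+1)^m·a^{K−j})` for any common letter
`a ≥ max(a₁, a₂)` — the profile of `hSle` for the WHOLE ledger (`E₀ := E₁ + E₂`). -/
theorem sizeProfile_join {S₁ S₂ vol E₁ E₂ a₁ a₂ a : ℝ} {K j m : ℕ} (hvol : 0 ≤ vol) (hE₁ : 0 ≤ E₁) (hE₂ : 0 ≤ E₂)
    (ha₁ : 0 ≤ a₁) (ha₂ : 0 ≤ a₂) (h₁ : a₁ ≤ a) (h₂ : a₂ ≤ a)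
    (hS₁ : S₁ ≤ vol * (E₁ * ((K : ℝ) + 1) ^ m * a₁ ^ (K - j))) (hS₂ : S₂ ≤ vol * (E₂ * a₂ ^ (K - j))) :
    S₁ + S₂ ≤ vol * ((E₁ + E₂) * ((K : ℝ) + 1) ^ m * a ^ (K - j)) := by
  have hKm : (1 : ℝ) ≤ ((K : ℝ) + 1) ^ m := one_le_pow₀ (by exact_mod_cast Nat.le_add_left 1 K)
  have hw : (0 : ℝ) ≤ ((K : ℝ) + 1) ^ m := zero_le_one.trans hKm
  have h1 : S₁ ≤ vol * (E₁ * ((K : ℝ) + 1) ^ m * a ^ (K - j)) := hS₁.trans (profile_mono hvol hE₁ hw ha₁ h₁ _)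
  have h2 : S₂ ≤ vol * (E₂ * ((K : ℝ) + 1) ^ m * a ^ (K - j)) := by
    refine hS₂.trans ((profile_mono hvol hE₂ zero_le_one ha₂ h₂ (K - j)).trans' ?_ |>.trans ?_)
    · rw [mul_one]
    · rw [mul_one]
      exact mul_le_mul_of_nonneg_left (mul_le_mul_of_nonneg_right (le_mul_of_one_le_right hE₂ hKm)
        (pow_nonneg (ha₂.trans h₂) _)) hvol
  calc S₁ + S₂ ≤ vol * (E₁ * ((K : ℝ) + 1) ^ m * a ^ (K - j)) + vol * (E₂ * ((K : ℝ) + 1) ^ m * a ^ (K - j)) :=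
        add_le_add h1 h2
    _ = vol * ((E₁ + E₂) * ((K : ℝ) + 1) ^ m * a ^ (K - j)) := by ring

/-- **THE SLICE FORM** [folklore]: with the ledger marked into vacuum ∕ dressed parts, a vacuum slice bound of (2.43)-profile and a
dressed slice bound of §2's profile give N19's `hS` ∧ `hSle` for the WHOLE slice with ONE profile
`vol·((E₁+E₂)·(K+1)^m·a^{K−j})`, `a ≥ max(a₁, a₂)` (`abs_sliceSum_split` + `sizeProfile_join`). -/
theorem hSle_of_vacuum_add_dressed {D : Type*} (wf : Finset D) (sc : D → ℕ) (f : D → ℝ) (dressed : D → Prop)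
    [DecidablePred dressed] {vol E₁ E₂ a₁ a₂ a : ℝ} {K j m : ℕ} (hvol : 0 ≤ vol) (hE₁ : 0 ≤ E₁) (hE₂ : 0 ≤ E₂)
    (ha₁ : 0 ≤ a₁) (ha₂ : 0 ≤ a₂) (h₁ : a₁ ≤ a) (h₂ : a₂ ≤ a)
    (hvac : |∑ X ∈ (wf.filter fun X => ¬ dressed X) with sc X = j, f X| ≤ vol * (E₁ * ((K : ℝ) + 1) ^ m * a₁ ^ (K - j)))
    (hdr : |∑ X ∈ (wf.filter fun X => dressed X) with sc X = j, f X| ≤ vol * (E₂ * a₂ ^ (K - j))) :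
    |∑ X ∈ wf with sc X = j, f X| ≤ vol * ((E₁ + E₂) * ((K : ℝ) + 1) ^ m * a ^ (K - j)) :=
  (abs_sliceSum_split wf sc f j dressed).trans (sizeProfile_join hvol hE₁ hE₂ ha₁ ha₂ h₁ h₂ hvac hdr)

end Join

/-! ## §4 Guard: the displayed identification binders are jointly satisfiable on the owner's toy tower, non-degenerately -/

section Toy

/-- **§2 FIRES ON THE OWNER's TOY TOWER** [decided toy]: for the one-family toy tower (N14 at its count rate `2`, multiplicity `1`,
POSITIVE sizes — module 1's `n14_toyTower_pinned`), the one-domain ledger `{⋆}` at scale `0` reading run A's entry as the toy's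
own final-scale size and run B's entry as `0` (a NONZERO two-run discrepancy) meets EVERY displayed identification binder of
`sizeBinder_dressed_of_n14_pinned` (birth scale aligned, injective, felt at the one top cube, `#Q = 1 ≤ vol = 1`, dominated), and
the face then bounds the toy's own positive size by its profile: constants `A₀, ρ ≥ 0`, `2ρ < 1`, with
`0 < size ⋆ K ≤ 1·((2·1·A₀)·(2ρ)^{K})` at every cutoff `K`.  Nothing of Bałaban's is modelled. [folklore] -/
theorem sizeBinder_dressed_toyTower :
    ∃ A₀ ρ : ℝ, 0 ≤ A₀ ∧ 0 ≤ ρ ∧ ρ * 2 < 1 ∧ ∀ K : ℕ,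
      0 < (toyBooking K).size () K ∧ (toyBooking K).size () K ≤ 1 * ((2 * 1 * A₀) * (ρ * 2) ^ K) := by
  obtain ⟨A₀, ρ, hA₀, hρ, h1, hface⟩ :=
    sizeBinder_dressed_of_n14_pinned (𝒯 := toyTower) (Λ := 2) (Λ₀ := 2) (N₀ := 1)
      ⟨n14_toyTower_pinned.1, n14_toyTower_pinned.2.1⟩ zero_le_one (by norm_num) le_rfl
  refine ⟨A₀, ρ, hA₀, hρ, h1, fun K => ⟨toy_size_pos K K (), ?_⟩⟩
  have h := hface (D := Unit) {()} (fun _ => 0) (fun _ => (toyBooking K).size () K) (fun _ => 0) 1 K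
    () (fun _ => ()) {⟨K, Nat.lt_succ_self K⟩} () K (fun _ => ())
    (fun _ _ => rfl) (fun _ a _ b _ _ => Subsingleton.elim a b) (fun q hq => by
      rw [Finset.mem_singleton] at hq; subst hq; rfl) (by simp)
    (fun _ _ => ⟨⟨K, Nat.lt_succ_self K⟩, Finset.mem_singleton_self _, Finset.mem_singleton_self _⟩)
    (fun _ _ => rfl)
    (fun _ _ => by rw [abs_of_nonneg ((toyBooking K).size_nonneg () K)]; exact le_rfl)
    (fun _ _ => by rw [abs_zero]; exact (toyBooking K).size_nonneg () K) 0 (Nat.zero_le K)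
  have hs : ∑ X ∈ ({()} : Finset Unit) with (fun _ : Unit => (0 : ℕ)) X = 0, ((0 : ℝ) - (toyBooking K).size () K)
      = -(toyBooking K).size () K := by simp
  rw [hs, abs_neg, abs_of_nonneg ((toyBooking K).size_nonneg () K), Nat.sub_zero] at h
  exact h

end Toy

/-! ## §5 (v1.1) The consumers read of N14 only its FINAL-SCALE PROFILE `size b K ≤ A₀ρ^{K−j}` (REPAIR CENSUS (r4)) -/

section FinalProfile

variable {P : Type*} {𝒯 : DressedTower P}

/-- **THE FACE FROM THE FINAL-SCALE PROFILE ALONE** [bookkeeping]: ONE `(A₀, ρ)` bounding every booked term at the FINAL scale by `A₀·ρ^{K−j}`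
(no intermediate-scale class asked) gives N19's `hS` ∧ `hSle` (`E₀ = 2N₀A₀`, `m = 0`, `a = ρΛ₀`) — the road reads ONLY this profile. [folklore] -/
theorem sizeBinder_dressed_of_finalProfile {A₀ ρ N₀ Λ₀ : ℝ} (hA₀ : 0 ≤ A₀) (hρ : 0 ≤ ρ)
    (hfin : ∀ (p : P) (K : ℕ) (b : (𝒯.B p K).Birth), (𝒯.B p K).size b K ≤ A₀ * ρ ^ (K - (𝒯.B p K).birthScale b))
    {D : Type*} (wf : Finset D) (sc : D → ℕ) (eA eB : D → ℝ) (vol : ℝ) (K : ℕ)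
    (pA : P) (KA : ℕ) (βA : D → (𝒯.B pA KA).Birth) (pB : P) (KB : ℕ) (βB : D → (𝒯.B pB KB).Birth)
    (hscA : ∀ X ∈ wf, KA - (𝒯.B pA KA).birthScale (βA X) = K - sc X)
    (hscB : ∀ X ∈ wf, KB - (𝒯.B pB KB).birthScale (βB X) = K - sc X)
    (hdomA : ∀ X ∈ wf, |eA X| ≤ (𝒯.B pA KA).size (βA X) KA)
    (hdomB : ∀ X ∈ wf, |eB X| ≤ (𝒯.B pB KB).size (βB X) KB)
    (hcnt : ∀ j, j ≤ K → ((wf.filter fun X => sc X = j).card : ℝ) ≤ vol * (N₀ * Λ₀ ^ (K - j))) :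
    ∀ j, j ≤ K → |∑ X ∈ wf with sc X = j, (eB X - eA X)| ≤ vol * ((2 * N₀ * A₀) * (ρ * Λ₀) ^ (K - j)) := by
  intro j hj
  have hA : ∀ X ∈ wf, sc X = j → |eA X| ≤ A₀ * ρ ^ (K - j) := fun X hX hXj =>
    (hdomA X hX).trans (by rw [← hXj, ← hscA X hX]; exact hfin pA KA (βA X))
  have hB : ∀ X ∈ wf, sc X = j → |eB X| ≤ A₀ * ρ ^ (K - j) := fun X hX hXj =>
    (hdomB X hX).trans (by rw [← hXj, ← hscB X hX]; exact hfin pB KB (βB X))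
  calc |∑ X ∈ wf with sc X = j, (eB X - eA X)|
      ≤ (A₀ * ρ ^ (K - j) + A₀ * ρ ^ (K - j)) * (vol * (N₀ * Λ₀ ^ (K - j))) := abs_sliceSum_sub_le wf sc eA eB j hA hB
          (mul_nonneg hA₀ (pow_nonneg hρ _)) (mul_nonneg hA₀ (pow_nonneg hρ _)) (hcnt j hj)
    _ = vol * ((2 * N₀ * A₀) * (ρ * Λ₀) ^ (K - j)) := by rw [mul_pow]; ring

/-- **ROOT-C OF RECORD ⇒ THE FINAL-SCALE PROFILE WITH THE LETTER** [bookkeeping] (`unitLattice_of_n14`): the consumer-exact reading of N14 —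
a record predicate stating THIS (weaker than ROOT-C) would close every by-name arrow of modules 1 §5, 4, 5; typing observation only (R434). [folklore] -/
theorem finalProfile_of_n14 {Λ : ℝ} (h : DressedStabilityStrict 𝒯 Λ) :
    ∃ A₀ ρ : ℝ, 0 ≤ A₀ ∧ 0 ≤ ρ ∧ 0 ≤ Λ ∧ ρ * Λ < 1 ∧
      ∀ (p : P) (K : ℕ) (b : (𝒯.B p K).Birth), (𝒯.B p K).size b K ≤ A₀ * ρ ^ (K - (𝒯.B p K).birthScale b) := by
  obtain ⟨A₀, ρ, hA₀, hρ, hΛ, h1, hfin, -⟩ := unitLattice_of_n14 h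
  exact ⟨A₀, ρ, hA₀, hρ, hΛ, h1, hfin⟩

/-- **A3 FOR THE FINAL-SCALE READING: NOT FOR FREE** [decided toy]: on the owner's doubling tower `growingTower` (sizes `2^k`, born at
scale `0`) at its count rate `1`, NO `(A₀, ρ)` with `ρ·1 < 1` bounds the final-scale sizes by `A₀ρ^{K−j}`. [folklore] -/
theorem finalProfile_not_for_free :
    ¬ ∃ A₀ ρ : ℝ, 0 ≤ ρ ∧ ρ * 1 < 1 ∧
      ∀ (p : Unit) (K : ℕ) (b : (growingTower.B p K).Birth),
        (growingTower.B p K).size b K ≤ A₀ * ρ ^ (K - (growingTower.B p K).birthScale b) := by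
  rintro ⟨A₀, ρ, hρ, h1, h⟩
  have h0 : (2 : ℝ) ^ 0 ≤ A₀ * ρ ^ (0 - 0) := h () 0 ()
  rw [pow_zero, Nat.sub_zero, pow_zero, mul_one] at h0
  have hK : ∀ K : ℕ, (2 : ℝ) ^ K ≤ A₀ := fun K => by
    have hb : (2 : ℝ) ^ K ≤ A₀ * ρ ^ (K - 0) := h () K ()
    exact hb.trans (mul_le_of_le_one_right (zero_le_one.trans h0) (pow_le_one₀ hρ (by simpa using h1.le)))
  exact (pow_unbounded_of_one_lt A₀ (one_lt_two : (1 : ℝ) < 2)).elim fun n hn => absurd (hK n) (not_le.mpr hn)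

end FinalProfile
end YMDAG.N14

end
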